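import Literature.NumberTheory.Rogawski1990.AdelicStableOrbitalIntegrableG2OfKConj
import HarnessLib

/-!
# Class-weighted («κ» ∕ Kottwitz-signed) adelic orbital sums, I: class-weight algebra + weighted Euler discharge on the (G2) carrier
(Rogawski (1990), §4.1 (4.1.2) p. 40, §4.3 p. 44, §5.4 (5.4.3) pp. 72–73; Kottwitz (1986), Prop. 7.1, Cor. 7.3)

Topic `NumberTheory/Rogawski1990`; namespace `Literature.NumberTheory.Rogawski1990`; **THEOREMS ONLY** (no definition, no named fact, no instance, no
notation, no `sorry`).  Cell `pub/hodgecm-mathlib`, ENGINE T1 (crux H413 = `stmt-HodgeConjecture-24833`), row O7 «singular semisimple classes», piece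
**(SA-st-w) §1–§2** (O7 OWNER WORDS #24–#27; F0P3a-plan RULING #116 «Kottwitz signs»): print's stable ∕ κ-orbital integrals at a NON-regular semisimple class
carry signs `e(γ′)` [(4.1.2)]; in the tree's currency a SIGNED adelic sum is the weight-parametric ★ `adelicKappaOrbitalSum 𝒞 w m f`.  §1 moves a CLASS
WEIGHT `w : ConjClasses Γ → ℂ` into the test function (`Φ_m(c, (w ∘ [·]) · f) = w(c) · Φ_m(c, f)`, hence `Σ_{c ∈ 𝒞} w(c) Φ(c, f) = Σ_{c ∈ 𝒞} Φ(c, (w ∘ [·]) · f)`);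
§2 is the WEIGHTED twin of ★ (ζ1″) `MatchingAdeleG₂.exists_forall_isEulerOnClasses_ofLocalAdelic_of_mul_sub_eq_zero` for a weight that is EULER on the carrier
(`w(c) = warch[c_∞] · ∏_{v ∈ S_w(c)} wloc_v[c_v]`, `wloc_v = 1` off `S_w(c)`, `wloc_v[γ_v] = 1` a.e. — the shape of `e_𝐀 = e_∞ · ∏ᶠ_v e_v`): the weighted adelic sum
over `𝒞_𝐀(γ₀)` is Euler with the WEIGHTED local ∕ archimedean stable sums as factors.  Letter-independent (the ★-pending `KottwitzSignCM` weights instantiate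
`w`, `wloc`, `warch`).  HC_CM is proved only modulo the printed citations until rung 0 closes; this file consumes none of them.

## References
* [Rogawski1990] J. D. Rogawski, *Automorphic Representations of Unitary Groups in Three Variables* (1990), §4.1 (4.1.2), §4.3, §5.4 (5.4.3), §14.5.
* [Kottwitz1986] R. E. Kottwitz, *Stable trace formula: elliptic singular terms*, Math. Ann. 275 (1986), 365–399, Prop. 7.1, Cor. 7.3, §9.
-/

set_option autoImplicit false

noncomputable section

open MeasureTheory NumberField IsDedekindDomain Topology Function Filter
open scoped Matrix MatrixGroups

namespace Literature.NumberTheory.Rogawski1990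

open Literature.NumberTheory.Automorphic Literature.MeasureTheory.Group Literature.LinearAlgebra.Matrix
open Literature.AlgebraicGeometry.ShimuraVarieties (unitaryGroup)

/-! ## §1 Class weights: `Φ(γ, (w ∘ [·]) · f) = w[γ] · Φ(γ, f)` -/

section ClassWeight

variable {G : Type*} [Group G]

/-- The orbital integrand of a CLASS-WEIGHTED function `x ↦ w[x] · f(x)` at `γ` is `w[γ]` times the integrand of `f` (every conjugate `y γ y⁻¹` has the
class of `γ`). [cite: Rogawski1990, §4.1 (4.1.2) p. 40] -/
theorem descConj_classWeight_mul (γ : G) (M : Subgroup G) (hM : ∀ m ∈ M, m * γ = γ * m) (w : ConjClasses G → ℂ) (f : G → ℂ) :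
    descConj γ M hM (fun x => w (ConjClasses.mk x) * f x) = fun y => w (ConjClasses.mk γ) * descConj γ M hM f y := by
  funext y
  induction y using QuotientGroup.induction_on with
  | H g =>
    simp only [descConj_mk]
    have h : ConjClasses.mk (g * γ * g⁻¹) = ConjClasses.mk γ :=
      (ConjClasses.mk_eq_mk_iff_isConj.2 (isConj_iff.2 ⟨g, rfl⟩)).symm
    rw [h]

variable [∀ γ : G, MeasurableSpace (G ⧸ Subgroup.centralizer ({γ} : Set G))]

/-- **`Φ(γ, (w ∘ [·]) · f; m) = w[γ] · Φ(γ, f; m)`** — a class weight factors out of the orbital integral. [cite: Rogawski1990, §4.1 (4.1.2) p. 40] -/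
theorem orbitalIntegral_classWeight_mul (γ : G) (w : ConjClasses G → ℂ) (f : G → ℂ)
    (m : Measure (G ⧸ Subgroup.centralizer ({γ} : Set G))) :
    orbitalIntegral γ (fun x => w (ConjClasses.mk x) * f x) m = w (ConjClasses.mk γ) * orbitalIntegral γ f m := by
  rw [orbitalIntegral, orbitalIntegral, descConj_classWeight_mul, integral_const_mul]

/-- **`Φ_m(c, (w ∘ [·]) · f) = w(c) · Φ_m(c, f)`** on conjugacy classes. [cite: Rogawski1990, §4.1 (4.1.2) p. 40] -/
theorem classOrbitalIntegral_classWeight_mul (m : OrbitalMeasureFamily G) (w : ConjClasses G → ℂ) (f : G → ℂ) (c : ConjClasses G) :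
    classOrbitalIntegral m (fun x => w (ConjClasses.mk x) * f x) c = w c * classOrbitalIntegral m f c := by
  rw [classOrbitalIntegral_eq, classOrbitalIntegral_eq, orbitalIntegral_classWeight_mul, conjClasses_mk_out_eq]

/-- The support of the weighted class orbital integrals lies in the support of the unweighted ones. [cite: Rogawski1990, §4.1 (4.1.2) p. 40] -/
theorem support_classOrbitalIntegral_classWeight_mul_subset (m : OrbitalMeasureFamily G) (w : ConjClasses G → ℂ) (f : G → ℂ) :
    support (classOrbitalIntegral m (fun x => w (ConjClasses.mk x) * f x)) ⊆ support (classOrbitalIntegral m f) := by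
  intro c hc
  rw [mem_support, classOrbitalIntegral_classWeight_mul] at hc
  exact right_ne_zero_of_mul hc

/-- **The κ-weighted adelic sum IS the stable (unweighted) sum of the class-weighted function**:
`Σ_{c ∈ 𝒞} w(c) Φ_m(c, f) = Σ_{c ∈ 𝒞} Φ_m(c, (w ∘ [·]) · f)`. [cite: Rogawski1990, §4.1 (4.1.2) p. 40; §4.3 p. 44] -/
theorem adelicKappaOrbitalSum_eq_adelicStableOrbitalSum_classWeight_mul (𝒞 : Set (ConjClasses G)) (w : ConjClasses G → ℂ)
    (m : OrbitalMeasureFamily G) (f : G → ℂ) :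
    adelicKappaOrbitalSum 𝒞 w m f = adelicStableOrbitalSum 𝒞 m (fun x => w (ConjClasses.mk x) * f x) := by
  rw [adelicKappaOrbitalSum_def, adelicStableOrbitalSum_def]
  exact finsum_mem_congr rfl fun c _ => (classOrbitalIntegral_classWeight_mul m w f c).symm

omit [∀ γ : G, MeasurableSpace (G ⧸ Subgroup.centralizer ({γ} : Set G))] in
/-- The integrand of the class-weighted function is integrable when the unweighted one is. [cite: Rogawski1990, §4.1 (4.1.2) p. 40] -/
theorem integrable_descConj_classWeight_mul {γ : G} {M : Subgroup G} (hM : ∀ x ∈ M, x * γ = γ * x) [MeasurableSpace (G ⧸ M)]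
    {μ : Measure (G ⧸ M)} (w : ConjClasses G → ℂ) {f : G → ℂ} (hf : Integrable (descConj γ M hM f) μ) :
    Integrable (descConj γ M hM (fun x => w (ConjClasses.mk x) * f x)) μ := by
  rw [descConj_classWeight_mul]
  exact hf.const_mul _

end ClassWeight

/-! ## §2 The weighted Euler discharge on the (G2) carrier `𝒞_𝐀(γ₀) ⊂ ConjClasses U(H₂)(𝐀)` -/

section EulerG2

variable {L : Type} [Field L] [NumberField L] [IsCMField L] {H₁ H₂ : Matrix (Fin 3) (Fin 3) L}
  {γ₀ : (UnitaryGroup.cmDatum L 3 H₁).Rational} {γ : (UnitaryGroup.cmDatum L 3 H₂).Rational}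
  [∀ g : (UnitaryGroup.cmDatum L 3 H₂).Adelic,
    MeasurableSpace ((UnitaryGroup.cmDatum L 3 H₂).Adelic ⧸ Subgroup.centralizer ({g} : Set (UnitaryGroup.cmDatum L 3 H₂).Adelic))]
  [∀ g : (UnitaryGroup.cmDatum L 3 H₂).Adelic,
    BorelSpace ((UnitaryGroup.cmDatum L 3 H₂).Adelic ⧸ Subgroup.centralizer ({g} : Set (UnitaryGroup.cmDatum L 3 H₂).Adelic))]
  [∀ (v : HeightOneSpectrum (𝓞 ↥(maximalRealSubfield L))) (x : (UnitaryGroup.cmDatum L 3 H₂).Local v),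
    MeasurableSpace ((UnitaryGroup.cmDatum L 3 H₂).Local v ⧸ Subgroup.centralizer ({x} : Set ((UnitaryGroup.cmDatum L 3 H₂).Local v)))]
  [∀ (v : HeightOneSpectrum (𝓞 ↥(maximalRealSubfield L))) (x : (UnitaryGroup.cmDatum L 3 H₂).Local v),
    BorelSpace ((UnitaryGroup.cmDatum L 3 H₂).Local v ⧸ Subgroup.centralizer ({x} : Set ((UnitaryGroup.cmDatum L 3 H₂).Local v)))]
  [∀ a : UnitaryGroup.arch (↥(maximalRealSubfield L)) L (IsCMField.complexConj L) 3 H₂,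
    MeasurableSpace (UnitaryGroup.arch (↥(maximalRealSubfield L)) L (IsCMField.complexConj L) 3 H₂ ⧸
      Subgroup.centralizer ({a} : Set (UnitaryGroup.arch (↥(maximalRealSubfield L)) L (IsCMField.complexConj L) 3 H₂)))]
  [∀ a : UnitaryGroup.arch (↥(maximalRealSubfield L)) L (IsCMField.complexConj L) 3 H₂,
    BorelSpace (UnitaryGroup.arch (↥(maximalRealSubfield L)) L (IsCMField.complexConj L) 3 H₂ ⧸
      Subgroup.centralizer ({a} : Set (UnitaryGroup.arch (↥(maximalRealSubfield L)) L (IsCMField.complexConj L) 3 H₂)))]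

set_option maxHeartbeats 400000 in
/-- **THE WEIGHTED EULER DISCHARGE on `𝒞_𝐀(γ₀) ⊂ ConjClasses U(H₂)(𝐀)` AT THE RELATIVE CLAUSE** — ★ (ζ1) for the CLASS-WEIGHTED function `x ↦ w[x] · T(x)`,
`w` EULER on the carrier (`hwE`) and trivial at almost every local base class (`hw1`): the weighted adelic sum factors into the weighted local ∕ archimedean
stable sums.  Same proof as ★ (ζ1), every class orbital integral multiplied by its weight (§1). [cite: Rogawski1990, §4.1 (4.1.2) p. 40; §4.3 p. 44; §5.4 (5.4.3) pp. 72–73]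
[cite: Kottwitz1986, Prop. 7.1, Cor. 7.3] -/
theorem MatchingAdeleG₂.exists_isEulerOnClasses_ofLocalAdelic_classWeight_of_eventuallyKConj (hH₂ : (H₂.map (cmConjRingHom L))ᵀ = H₂) (hdet : H₂.det ≠ 0)
    (hγ : Corresponds (cmConjRingHom L) H₁ H₂ γ₀ γ)
    (hKrel : ∀ᶠ v in cofinite, ∀ g g' : (UnitaryGroup.cmDatum L 3 H₂).Local v,
      g ∈ UnitaryGroup.cmLocalIntegralLevel L 3 H₂ v → g' ∈ UnitaryGroup.cmLocalIntegralLevel L 3 H₂ v →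
        Corresponds (UnitaryGroup.conjLocal L (IsCMField.complexConj L) v) ((UnitaryGroup.adelicForm L 3 H₁).map (UnitaryGroup.adeleToLocal L v))
          ((UnitaryGroup.adelicForm L 3 H₂).map (UnitaryGroup.adeleToLocal L v)) ((UnitaryGroup.cmDatum L 3 H₁).toLocal v ((UnitaryGroup.cmDatum L 3 H₁).toAdelic γ₀)) g →
        Corresponds (UnitaryGroup.conjLocal L (IsCMField.complexConj L) v) ((UnitaryGroup.adelicForm L 3 H₁).map (UnitaryGroup.adeleToLocal L v))
          ((UnitaryGroup.adelicForm L 3 H₂).map (UnitaryGroup.adeleToLocal L v)) ((UnitaryGroup.cmDatum L 3 H₁).toLocal v ((UnitaryGroup.cmDatum L 3 H₁).toAdelic γ₀)) g' →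
          ∃ k ∈ UnitaryGroup.cmLocalIntegralLevel L 3 H₂ v, k * g * k⁻¹ = g')
    (mq : ∀ v : HeightOneSpectrum (𝓞 ↥(maximalRealSubfield L)),
      OrbitalMeasureFamily ((UnitaryGroup.cmDatum L 3 H₂).Local v))
    (mqi : OrbitalMeasureFamily (UnitaryGroup.arch (↥(maximalRealSubfield L)) L (IsCMField.complexConj L) 3
      H₂))
    (hadm : ∀ v, (mq v).IsAdmissibleOn fun x : (UnitaryGroup.cmDatum L 3 H₂).Local v =>
      Corresponds (UnitaryGroup.conjLocal L (IsCMField.complexConj L) v)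
        ((UnitaryGroup.adelicForm L 3 H₁).map (UnitaryGroup.adeleToLocal L v))
        ((UnitaryGroup.adelicForm L 3 H₂).map (UnitaryGroup.adeleToLocal L v))
        ((UnitaryGroup.cmDatum L 3 H₁).toLocal v ((UnitaryGroup.cmDatum L 3 H₁).toAdelic γ₀)) x)
    (hadmA : mqi.IsAdmissibleOn fun a : UnitaryGroup.arch (↥(maximalRealSubfield L)) L (IsCMField.complexConj L) 3 H₂ =>
      Corresponds (UnitaryGroup.conjMixed (↥(maximalRealSubfield L)) L (IsCMField.complexConj L)) (UnitaryGroup.archFormOf L 3 H₁)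
        (UnitaryGroup.archFormOf L 3 H₂) (cmRationalToArch L 3 H₁ γ₀) a)
    (hO : ∀ v : HeightOneSpectrum (𝓞 ↥(maximalRealSubfield L)),
      IsClosed {x : GL (Fin 3) (UnitaryGroup.LocalRing L v) | ∃ g : GL (Fin 3) (UnitaryGroup.LocalRing L v),
        g * (((UnitaryGroup.cmDatum L 3 H₂).toLocal v ((UnitaryGroup.cmDatum L 3 H₂).toAdelic γ)).val :
          GL (Fin 3) (UnitaryGroup.LocalRing L v)) * g⁻¹ = x})
    (hOi : IsClosed {x : GL (Fin 3) (mixedEmbedding.mixedSpace L) | ∃ g : GL (Fin 3) (mixedEmbedding.mixedSpace L),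
        g * ((cmRationalToArch L 3 H₂ γ).val : GL (Fin 3) (mixedEmbedding.mixedSpace L)) * g⁻¹ = x})
    (hnormγ : ∃ S₀ : Finset (HeightOneSpectrum (𝓞 ↥(maximalRealSubfield L))),
      UnitaryGroup.IsNormalisedOff L 3 H₂ mq
        ((UnitaryGroup.cmDatum L 3 H₂).toAdelic γ) S₀)
    (hnorm : ∀ p : MatchingAdeleG₂ L H₁ H₂ γ₀, ∃ S₀ : Finset (HeightOneSpectrum (𝓞 ↥(maximalRealSubfield L))),
      UnitaryGroup.IsNormalisedOff L 3 H₂ mq p.adele S₀)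
    (T : UnitaryGroup.PureTensor L 3 H₂) (hT : T.IsTest)
    (hFi : ∀ c ∈ MatchingAdeleG₂.classes L H₁ H₂ γ₀, Integrable
      (descConj (Quotient.out c : (UnitaryGroup.cmDatum L 3 H₂).Adelic)
        (Subgroup.centralizer ({(Quotient.out c : (UnitaryGroup.cmDatum L 3 H₂).Adelic)} :
          Set (UnitaryGroup.cmDatum L 3 H₂).Adelic))
        (centralizer_comm _) T.eval)
      (UnitaryGroup.OrbitalMeasureFamily.ofLocalAdelic L 3 H₂ mq mqi c))
    -- the class weights: adelic, local, archimedean; Euler on the carrier; trivial at almost every local base point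
    (w : ConjClasses (UnitaryGroup.cmDatum L 3 H₂).Adelic → ℂ)
    (wloc : ∀ v : HeightOneSpectrum (𝓞 ↥(maximalRealSubfield L)), ConjClasses ((UnitaryGroup.cmDatum L 3 H₂).Local v) → ℂ)
    (warch : ConjClasses (UnitaryGroup.arch (↥(maximalRealSubfield L)) L (IsCMField.complexConj L) 3 H₂) → ℂ)
    (hwE : ∀ c ∈ MatchingAdeleG₂.classes L H₁ H₂ γ₀, ∃ Sw : Finset (HeightOneSpectrum (𝓞 ↥(maximalRealSubfield L))),
      (∀ v ∉ Sw, wloc v (ConjClasses.mk ((UnitaryGroup.cmDatum L 3 H₂).toLocal v (Quotient.out c))) = 1) ∧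
      w c = warch (ConjClasses.mk (UnitaryGroup.archPart (↥(maximalRealSubfield L)) L (IsCMField.complexConj L) 3 H₂ (Quotient.out c))) *
        ∏ v ∈ Sw, wloc v (ConjClasses.mk ((UnitaryGroup.cmDatum L 3 H₂).toLocal v (Quotient.out c))))
    (hw1 : ∀ᶠ v in cofinite, wloc v (ConjClasses.mk ((UnitaryGroup.cmDatum L 3 H₂).toLocal v ((UnitaryGroup.cmDatum L 3 H₂).toAdelic γ))) = 1) :
    ∃ S₁ : Finset (HeightOneSpectrum (𝓞 ↥(maximalRealSubfield L))), ∀ S : Finset (HeightOneSpectrum (𝓞 ↥(maximalRealSubfield L))), S₁ ⊆ S →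
      IsEulerOnClasses (MatchingAdeleG₂.classes L H₁ H₂ γ₀)
        (UnitaryGroup.OrbitalMeasureFamily.ofLocalAdelic L 3 H₂ mq mqi) (fun x => w (ConjClasses.mk x) * T.eval x) S
        (fun v => localStableOrbitalIntegral L 3 H₂ v (mq v) (fun y => wloc v (ConjClasses.mk y) * T.loc v y)
          ((UnitaryGroup.cmDatum L 3 H₂).toLocal v
            ((UnitaryGroup.cmDatum L 3 H₂).toAdelic γ)))
        (archStableOrbitalIntegral L 3 H₂ mqi (fun a => warch (ConjClasses.mk a) * T.arch a)
          (cmRationalToArch L 3 H₂ γ)) := by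
  classical
  have hadmAt : ∀ v (x : (UnitaryGroup.cmDatum L 3 H₂).Local v),
      Corresponds (UnitaryGroup.conjLocal L (IsCMField.complexConj L) v)
        ((UnitaryGroup.adelicForm L 3 H₁).map (UnitaryGroup.adeleToLocal L v))
        ((UnitaryGroup.adelicForm L 3 H₂).map (UnitaryGroup.adeleToLocal L v))
        ((UnitaryGroup.cmDatum L 3 H₁).toLocal v ((UnitaryGroup.cmDatum L 3 H₁).toAdelic γ₀)) x →
      mq v (ConjClasses.mk x) ≠ 0 ∧ SMulInvariantMeasure _ _ (mq v (ConjClasses.mk x)) ∧ IsFiniteMeasureOnCompacts (mq v (ConjClasses.mk x)) :=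
    fun v x hx => hadm v (ConjClasses.mk x) (hx.of_isStablyConj_right (isStablyConj_of_isConj (isConj_out_conjClasses_mk x)))
  -- (1) the clause made absolute at the integral base point `γ_v`
  have hKCev : ∀ᶠ v in cofinite, ∀ g : (UnitaryGroup.cmDatum L 3 H₂).Local v,
      g ∈ UnitaryGroup.cmLocalIntegralLevel L 3 H₂ v →
      Corresponds (UnitaryGroup.conjLocal L (IsCMField.complexConj L) v)
          ((UnitaryGroup.adelicForm L 3 H₁).map (UnitaryGroup.adeleToLocal L v))
          ((UnitaryGroup.adelicForm L 3 H₂).map (UnitaryGroup.adeleToLocal L v))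
          ((UnitaryGroup.cmDatum L 3 H₁).toLocal v ((UnitaryGroup.cmDatum L 3 H₁).toAdelic γ₀)) g →
        ∃ k ∈ UnitaryGroup.cmLocalIntegralLevel L 3 H₂ v,
          k * (UnitaryGroup.cmDatum L 3 H₂).toLocal v ((UnitaryGroup.cmDatum L 3 H₂).toAdelic γ) * k⁻¹ = g := by
    filter_upwards [hKrel,
      eventually_toLocal_mem_cmLocalIntegralLevel ((UnitaryGroup.cmDatum L 3 H₂).toAdelic γ)] with v hv hγint g hg hcg
    exact hv _ g hγint hg (corresponds_toLocal_toAdelic hγ v) hcg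
  have hKfin := Filter.eventually_cofinite.1 hKCev
  -- (2) the unit-factor places at the base class `[γ_v]` (★ K6-β at `H₂`)
  obtain ⟨S₀γ, hS₀γ⟩ := hnormγ
  have hunit := UnitaryGroup.eventually_classOrbitalIntegral_indicator_eq_one_of_integralConj L 3 H₂ mq γ
    (MatchingAdeleG₂.isConj_toLocal_of_eventuallyKConj hKrel hγ)
    (fun v => (hadmAt v _ (corresponds_toLocal_toAdelic hγ v)).2.1) hS₀γ
  have hUfin := Filter.eventually_cofinite.1 hunit
  have hWfin := Filter.eventually_cofinite.1 hw1
  refine ⟨T.S ∪ hKfin.toFinset ∪ hUfin.toFinset ∪ hWfin.toFinset, fun S hS => ?_⟩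
  have hS_T : ∀ v ∉ S, v ∉ T.S := fun v hv h =>
    hv (hS (Finset.mem_union_left _ (Finset.mem_union_left _ (Finset.mem_union_left _ h))))
  have hS_K : ∀ v ∉ S, ∀ g : (UnitaryGroup.cmDatum L 3 H₂).Local v,
      g ∈ UnitaryGroup.cmLocalIntegralLevel L 3 H₂ v →
      Corresponds (UnitaryGroup.conjLocal L (IsCMField.complexConj L) v)
          ((UnitaryGroup.adelicForm L 3 H₁).map (UnitaryGroup.adeleToLocal L v))
          ((UnitaryGroup.adelicForm L 3 H₂).map (UnitaryGroup.adeleToLocal L v))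
          ((UnitaryGroup.cmDatum L 3 H₁).toLocal v ((UnitaryGroup.cmDatum L 3 H₁).toAdelic γ₀)) g →
        ∃ k ∈ UnitaryGroup.cmLocalIntegralLevel L 3 H₂ v,
          k * (UnitaryGroup.cmDatum L 3 H₂).toLocal v
                ((UnitaryGroup.cmDatum L 3 H₂).toAdelic γ) * k⁻¹ = g := by
    intro v hv
    by_contra hnot
    exact hv (hS (Finset.mem_union_left _ (Finset.mem_union_left _ (Finset.mem_union_right _ (hKfin.mem_toFinset.2 hnot)))))
  have hS_U : ∀ v ∉ S, classOrbitalIntegral (mq v)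
      ((UnitaryGroup.cmLocalIntegralLevel L 3 H₂ v :
        Set ((UnitaryGroup.cmDatum L 3 H₂).Local v)).indicator fun _ => (1 : ℂ))
      (ConjClasses.mk ((UnitaryGroup.cmDatum L 3 H₂).toLocal v
        ((UnitaryGroup.cmDatum L 3 H₂).toAdelic γ))) = 1 := by
    intro v hv
    by_contra hnot
    exact hv (hS (Finset.mem_union_left _ (Finset.mem_union_right _ (hUfin.mem_toFinset.2 hnot))))
  have hS_W : ∀ v ∉ S, wloc v (ConjClasses.mk ((UnitaryGroup.cmDatum L 3 H₂).toLocal v ((UnitaryGroup.cmDatum L 3 H₂).toAdelic γ))) = 1 := by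
    intro v hv
    by_contra hnot
    exact hv (hS (Finset.mem_union_right _ (hWfin.mem_toFinset.2 hnot)))
  refine MatchingAdeleG₂.isEulerOnClasses_of_factor_of_eventuallyKConj hKrel hγ _ (fun x => w (ConjClasses.mk x) * T.eval x) mq
    (fun v y => wloc v (ConjClasses.mk y) * T.loc v y) mqi (fun a => warch (ConjClasses.mk a) * T.arch a) S
    (fun c hc => ?_) (fun v hv => ?_) (fun v hv d hd hne => ?_) (fun v _ => ?_) ?_
  · -- (fac) ★ C3 at the class `c`, unit factors off `S ∪ {v | local class of c ≠ [γ_v]} ∪ S_w(c)`, then the weights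
    obtain ⟨p, rfl⟩ := hc
    obtain ⟨Sw, hSw, hwc⟩ := hwE _ (MatchingAdeleG₂.mk_adele_mem_classes p)
    let q : MatchingAdeleG₂ L H₁ H₂ γ₀ := p.conj (Quotient.out (ConjClasses.mk p.adele)) (isConj_out_conjClasses_mk p.adele)
    have hq : q.adele = Quotient.out (ConjClasses.mk p.adele) := rfl
    obtain ⟨S₀, hS₀⟩ := hnorm q
    have hev := MatchingAdeleG₂.eventually_map_toLocal_eq_mk_of_eventuallyKConj hKrel hγ (MatchingAdeleG₂.mk_adele_mem_classes p)
    have hevfin := Filter.eventually_cofinite.1 hev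
    -- the unweighted unit factor off `S ∪ S_ev(c)`
    have hunit1 : ∀ v ∉ S ∪ hevfin.toFinset, classOrbitalIntegral (mq v) (T.loc v)
        (ConjClasses.mk ((UnitaryGroup.cmDatum L 3 H₂).toLocal v (Quotient.out (ConjClasses.mk p.adele)))) = 1 := by
      intro v hv
      have hvS : v ∉ S := fun h => hv (Finset.mem_union_left _ h)
      have hvE : ConjClasses.map ((UnitaryGroup.cmDatum L 3
          H₂).toLocal v) (ConjClasses.mk p.adele) =
          ConjClasses.mk ((UnitaryGroup.cmDatum L 3 H₂).toLocal v
            ((UnitaryGroup.cmDatum L 3 H₂).toAdelic γ)) := by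
        by_contra hnot
        exact hv (Finset.mem_union_right _ (hevfin.mem_toFinset.2 hnot))
      rw [← conjClasses_map_eq_mk_out ((UnitaryGroup.cmDatum L 3
          H₂).toLocal v) (ConjClasses.mk p.adele),
        hvE, (hT.isUnramified).loc_eq (hS_T v hvS)]
      exact hS_U v hvS
    refine ⟨S ∪ hevfin.toFinset ∪ Sw, fun v hv => ?_, ?_⟩
    · -- weighted unit factor off `S ∪ S_ev(c) ∪ S_w(c)`
      rw [classOrbitalIntegral_classWeight_mul, hSw v (fun h => hv (Finset.mem_union_right _ h)), one_mul]
      exact hunit1 v (fun h => hv (Finset.mem_union_left _ h))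
    · -- the product formula for `T`, times the Euler form of the weight
      have hfacT := UnitaryGroup.classOrbitalIntegral_ofLocalAdelic_eval_eq_mul_prod L 3 _ mq mqi (ConjClasses.mk p.adele) (by rw [hq] at hS₀; exact hS₀)
        (fun v => hadmAt v _ (by rw [← hq]; exact q.corresponds_toLocal v))
        (hadmA _ (Corresponds.of_isStablyConj_right (by rw [← hq]; exact q.corresponds_arch)
          ((UnitaryGroup.arch (↥(maximalRealSubfield L)) L (IsCMField.complexConj L) 3
            H₂).subtype.map_isConj (isConj_out_conjClasses_mk _))))
        T (S ∪ hevfin.toFinset ∪ Sw) hT.isUnramified (hFi _ (MatchingAdeleG₂.mk_adele_mem_classes p))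
        (fun v hv => hunit1 v (fun h => hv (Finset.mem_union_left _ h)))
      -- the weight over the larger finite set
      have hwprod : w (ConjClasses.mk p.adele) =
          warch (ConjClasses.mk (UnitaryGroup.archPart (↥(maximalRealSubfield L)) L (IsCMField.complexConj L) 3 H₂
            (Quotient.out (ConjClasses.mk p.adele)))) *
          ∏ v ∈ S ∪ hevfin.toFinset ∪ Sw, wloc v (ConjClasses.mk ((UnitaryGroup.cmDatum L 3 H₂).toLocal v (Quotient.out (ConjClasses.mk p.adele)))) := by
        rw [hwc]
        exact congrArg _ (Finset.prod_subset Finset.subset_union_right fun v _ hv => hSw v hv)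
      rw [classOrbitalIntegral_classWeight_mul, hfacT, hwprod, classOrbitalIntegral_classWeight_mul, mul_mul_mul_comm, ← Finset.prod_mul_distrib]
      refine congrArg _ (Finset.prod_congr rfl fun v _ => ?_)
      rw [classOrbitalIntegral_classWeight_mul]
  · -- (h1) the base class has unit factor off `S`
    rw [classOrbitalIntegral_classWeight_mul, hS_W v hv, one_mul, (hT.isUnramified).loc_eq (hS_T v hv)]
    exact hS_U v hv
  · -- (h0) off `S` the other classes of the local stable class have factor `0`
    rw [classOrbitalIntegral_classWeight_mul, (hT.isUnramified).loc_eq (hS_T v hv),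
      classOrbitalIntegral_indicator_eq_zero_of_corresponds_of_ne₂ v (hS_K v hv) (mq v) d hd hne, mul_zero]
  · -- (hfin)
    exact (finite_support_classOrbitalIntegral_inter_corresponds_local₂_of_isClosed hH₂ hdet hγ v (hO v) (mq v)
      (UnitaryGroup.PureTensor.hasCompactSupport_loc hT.isUnramified hT.isFinSmooth v)).subset
      (Set.inter_subset_inter_left _ (support_classOrbitalIntegral_classWeight_mul_subset _ _ _))
  · -- (hfinₐ)
    exact (finite_support_classOrbitalIntegral_inter_corresponds_arch₂_of_isClosed hH₂ hdet hγ hOi mqi hT.isArchTest.hasCompactSupport_arch).subset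
      (Set.inter_subset_inter_left _ (support_classOrbitalIntegral_classWeight_mul_subset _ _ _))

/-- The weighted Euler discharge on `𝒞_𝐀(γ₀)`, `hFi` DISCHARGED (★ ζ1″ §2). [cite: Rogawski1990, §4.1 (4.1.2) p. 40; §5.4 (5.4.3) pp. 72–73] [cite: Kottwitz1986, Prop. 7.1] -/
theorem MatchingAdeleG₂.exists_forall_isEulerOnClasses_ofLocalAdelic_classWeight_of_eventuallyKConj (hH₂ : (H₂.map (cmConjRingHom L))ᵀ = H₂)
    (hdet : H₂.det ≠ 0) (hγ : Corresponds (cmConjRingHom L) H₁ H₂ γ₀ γ)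
    (hKrel : ∀ᶠ v in cofinite, ∀ g g' : (UnitaryGroup.cmDatum L 3 H₂).Local v,
      g ∈ UnitaryGroup.cmLocalIntegralLevel L 3 H₂ v → g' ∈ UnitaryGroup.cmLocalIntegralLevel L 3 H₂ v →
        Corresponds (UnitaryGroup.conjLocal L (IsCMField.complexConj L) v) ((UnitaryGroup.adelicForm L 3 H₁).map (UnitaryGroup.adeleToLocal L v))
          ((UnitaryGroup.adelicForm L 3 H₂).map (UnitaryGroup.adeleToLocal L v)) ((UnitaryGroup.cmDatum L 3 H₁).toLocal v ((UnitaryGroup.cmDatum L 3 H₁).toAdelic γ₀)) g →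
        Corresponds (UnitaryGroup.conjLocal L (IsCMField.complexConj L) v) ((UnitaryGroup.adelicForm L 3 H₁).map (UnitaryGroup.adeleToLocal L v))
          ((UnitaryGroup.adelicForm L 3 H₂).map (UnitaryGroup.adeleToLocal L v)) ((UnitaryGroup.cmDatum L 3 H₁).toLocal v ((UnitaryGroup.cmDatum L 3 H₁).toAdelic γ₀)) g' →
          ∃ k ∈ UnitaryGroup.cmLocalIntegralLevel L 3 H₂ v, k * g * k⁻¹ = g')
    (mq : ∀ v : HeightOneSpectrum (𝓞 ↥(maximalRealSubfield L)),
      OrbitalMeasureFamily ((UnitaryGroup.cmDatum L 3 H₂).Local v))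
    (mqi : OrbitalMeasureFamily (UnitaryGroup.arch (↥(maximalRealSubfield L)) L (IsCMField.complexConj L) 3
      H₂))
    (hadm : ∀ v, (mq v).IsAdmissibleOn fun x : (UnitaryGroup.cmDatum L 3 H₂).Local v =>
      Corresponds (UnitaryGroup.conjLocal L (IsCMField.complexConj L) v)
        ((UnitaryGroup.adelicForm L 3 H₁).map (UnitaryGroup.adeleToLocal L v))
        ((UnitaryGroup.adelicForm L 3 H₂).map (UnitaryGroup.adeleToLocal L v))
        ((UnitaryGroup.cmDatum L 3 H₁).toLocal v ((UnitaryGroup.cmDatum L 3 H₁).toAdelic γ₀)) x)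
    (hadmA : mqi.IsAdmissibleOn fun a : UnitaryGroup.arch (↥(maximalRealSubfield L)) L (IsCMField.complexConj L) 3 H₂ =>
      Corresponds (UnitaryGroup.conjMixed (↥(maximalRealSubfield L)) L (IsCMField.complexConj L)) (UnitaryGroup.archFormOf L 3 H₁)
        (UnitaryGroup.archFormOf L 3 H₂) (cmRationalToArch L 3 H₁ γ₀) a)
    (hO : ∀ v : HeightOneSpectrum (𝓞 ↥(maximalRealSubfield L)),
      IsClosed {x : GL (Fin 3) (UnitaryGroup.LocalRing L v) | ∃ g : GL (Fin 3) (UnitaryGroup.LocalRing L v),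
        g * (((UnitaryGroup.cmDatum L 3 H₂).toLocal v ((UnitaryGroup.cmDatum L 3 H₂).toAdelic γ)).val :
          GL (Fin 3) (UnitaryGroup.LocalRing L v)) * g⁻¹ = x})
    (hOi : IsClosed {x : GL (Fin 3) (mixedEmbedding.mixedSpace L) | ∃ g : GL (Fin 3) (mixedEmbedding.mixedSpace L),
        g * ((cmRationalToArch L 3 H₂ γ).val : GL (Fin 3) (mixedEmbedding.mixedSpace L)) * g⁻¹ = x})
    (hnormγ : ∃ S₀ : Finset (HeightOneSpectrum (𝓞 ↥(maximalRealSubfield L))),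
      UnitaryGroup.IsNormalisedOff L 3 H₂ mq
        ((UnitaryGroup.cmDatum L 3 H₂).toAdelic γ) S₀)
    (hnorm : ∀ p : MatchingAdeleG₂ L H₁ H₂ γ₀, ∃ S₀ : Finset (HeightOneSpectrum (𝓞 ↥(maximalRealSubfield L))),
      UnitaryGroup.IsNormalisedOff L 3 H₂ mq p.adele S₀)
    (T : UnitaryGroup.PureTensor L 3 H₂) (hT : T.IsTest)
    (w : ConjClasses (UnitaryGroup.cmDatum L 3 H₂).Adelic → ℂ)
    (wloc : ∀ v : HeightOneSpectrum (𝓞 ↥(maximalRealSubfield L)), ConjClasses ((UnitaryGroup.cmDatum L 3 H₂).Local v) → ℂ)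
    (warch : ConjClasses (UnitaryGroup.arch (↥(maximalRealSubfield L)) L (IsCMField.complexConj L) 3 H₂) → ℂ)
    (hwE : ∀ c ∈ MatchingAdeleG₂.classes L H₁ H₂ γ₀, ∃ Sw : Finset (HeightOneSpectrum (𝓞 ↥(maximalRealSubfield L))),
      (∀ v ∉ Sw, wloc v (ConjClasses.mk ((UnitaryGroup.cmDatum L 3 H₂).toLocal v (Quotient.out c))) = 1) ∧
      w c = warch (ConjClasses.mk (UnitaryGroup.archPart (↥(maximalRealSubfield L)) L (IsCMField.complexConj L) 3 H₂ (Quotient.out c))) *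
        ∏ v ∈ Sw, wloc v (ConjClasses.mk ((UnitaryGroup.cmDatum L 3 H₂).toLocal v (Quotient.out c))))
    (hw1 : ∀ᶠ v in cofinite, wloc v (ConjClasses.mk ((UnitaryGroup.cmDatum L 3 H₂).toLocal v ((UnitaryGroup.cmDatum L 3 H₂).toAdelic γ))) = 1) :
    ∃ S₁ : Finset (HeightOneSpectrum (𝓞 ↥(maximalRealSubfield L))), ∀ S : Finset (HeightOneSpectrum (𝓞 ↥(maximalRealSubfield L))), S₁ ⊆ S →
      IsEulerOnClasses (MatchingAdeleG₂.classes L H₁ H₂ γ₀)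
        (UnitaryGroup.OrbitalMeasureFamily.ofLocalAdelic L 3 H₂ mq mqi) (fun x => w (ConjClasses.mk x) * T.eval x) S
        (fun v => localStableOrbitalIntegral L 3 H₂ v (mq v) (fun y => wloc v (ConjClasses.mk y) * T.loc v y)
          ((UnitaryGroup.cmDatum L 3 H₂).toLocal v
            ((UnitaryGroup.cmDatum L 3 H₂).toAdelic γ)))
        (archStableOrbitalIntegral L 3 H₂ mqi (fun a => warch (ConjClasses.mk a) * T.arch a)
          (cmRationalToArch L 3 H₂ γ)) :=
  MatchingAdeleG₂.exists_isEulerOnClasses_ofLocalAdelic_classWeight_of_eventuallyKConj hH₂ hdet hγ hKrel mq mqi hadm hadmA hO hOi hnormγ hnorm T hT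
    (fun c hc => MatchingAdeleG₂.integrable_descConj_ofLocalAdelic_of_mem_classes_of_eventuallyKConj hH₂ hdet hγ hKrel hO hOi mq mqi hadm hadmA hnorm T hT c hc)
    w wloc warch hwE hw1

/-- **THE WEIGHTED (G2)-EULER PROPERTY AT A SPLIT SEMISIMPLE CLASS, kit-side binders only** (`(γ₀ − a)(γ₀ − b) = 0`, `a ≠ b`; clause, closed orbits and
integrability are theorems as in ★ ζ1″ §4). [cite: Rogawski1990, §3.8 Prop. 3.8.1 p. 27; §4.1 (4.1.2) p. 40; §5.4 (5.4.3) pp. 72–73] [cite: Kottwitz1986, Prop. 7.1, Cor. 7.3] -/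
theorem MatchingAdeleG₂.exists_forall_isEulerOnClasses_ofLocalAdelic_classWeight_of_mul_sub_eq_zero (hH₂ : (H₂.map (cmConjRingHom L))ᵀ = H₂)
    (hdet : H₂.det ≠ 0) (hγ : Corresponds (cmConjRingHom L) H₁ H₂ γ₀ γ)
    {a b : L} (hab : a ≠ b)
    (hγab : ((((γ₀ : unitaryGroup (cmConjRingHom L) H₁).val : GL (Fin 3) L).val : Matrix (Fin 3) (Fin 3) L) - a • (1 : Matrix (Fin 3) (Fin 3) L)) *
      ((((γ₀ : unitaryGroup (cmConjRingHom L) H₁).val : GL (Fin 3) L).val : Matrix (Fin 3) (Fin 3) L) - b • (1 : Matrix (Fin 3) (Fin 3) L)) = 0)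
    (mq : ∀ v : HeightOneSpectrum (𝓞 ↥(maximalRealSubfield L)),
      OrbitalMeasureFamily ((UnitaryGroup.cmDatum L 3 H₂).Local v))
    (mqi : OrbitalMeasureFamily (UnitaryGroup.arch (↥(maximalRealSubfield L)) L (IsCMField.complexConj L) 3
      H₂))
    (hadm : ∀ v, (mq v).IsAdmissibleOn fun x : (UnitaryGroup.cmDatum L 3 H₂).Local v =>
      Corresponds (UnitaryGroup.conjLocal L (IsCMField.complexConj L) v)
        ((UnitaryGroup.adelicForm L 3 H₁).map (UnitaryGroup.adeleToLocal L v))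
        ((UnitaryGroup.adelicForm L 3 H₂).map (UnitaryGroup.adeleToLocal L v))
        ((UnitaryGroup.cmDatum L 3 H₁).toLocal v ((UnitaryGroup.cmDatum L 3 H₁).toAdelic γ₀)) x)
    (hadmA : mqi.IsAdmissibleOn fun a : UnitaryGroup.arch (↥(maximalRealSubfield L)) L (IsCMField.complexConj L) 3 H₂ =>
      Corresponds (UnitaryGroup.conjMixed (↥(maximalRealSubfield L)) L (IsCMField.complexConj L)) (UnitaryGroup.archFormOf L 3 H₁)
        (UnitaryGroup.archFormOf L 3 H₂) (cmRationalToArch L 3 H₁ γ₀) a)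
    (hnormγ : ∃ S₀ : Finset (HeightOneSpectrum (𝓞 ↥(maximalRealSubfield L))),
      UnitaryGroup.IsNormalisedOff L 3 H₂ mq
        ((UnitaryGroup.cmDatum L 3 H₂).toAdelic γ) S₀)
    (hnorm : ∀ p : MatchingAdeleG₂ L H₁ H₂ γ₀, ∃ S₀ : Finset (HeightOneSpectrum (𝓞 ↥(maximalRealSubfield L))),
      UnitaryGroup.IsNormalisedOff L 3 H₂ mq p.adele S₀)
    (T : UnitaryGroup.PureTensor L 3 H₂) (hT : T.IsTest)
    (w : ConjClasses (UnitaryGroup.cmDatum L 3 H₂).Adelic → ℂ)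
    (wloc : ∀ v : HeightOneSpectrum (𝓞 ↥(maximalRealSubfield L)), ConjClasses ((UnitaryGroup.cmDatum L 3 H₂).Local v) → ℂ)
    (warch : ConjClasses (UnitaryGroup.arch (↥(maximalRealSubfield L)) L (IsCMField.complexConj L) 3 H₂) → ℂ)
    (hwE : ∀ c ∈ MatchingAdeleG₂.classes L H₁ H₂ γ₀, ∃ Sw : Finset (HeightOneSpectrum (𝓞 ↥(maximalRealSubfield L))),
      (∀ v ∉ Sw, wloc v (ConjClasses.mk ((UnitaryGroup.cmDatum L 3 H₂).toLocal v (Quotient.out c))) = 1) ∧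
      w c = warch (ConjClasses.mk (UnitaryGroup.archPart (↥(maximalRealSubfield L)) L (IsCMField.complexConj L) 3 H₂ (Quotient.out c))) *
        ∏ v ∈ Sw, wloc v (ConjClasses.mk ((UnitaryGroup.cmDatum L 3 H₂).toLocal v (Quotient.out c))))
    (hw1 : ∀ᶠ v in cofinite, wloc v (ConjClasses.mk ((UnitaryGroup.cmDatum L 3 H₂).toLocal v ((UnitaryGroup.cmDatum L 3 H₂).toAdelic γ))) = 1) :
    ∃ S₁ : Finset (HeightOneSpectrum (𝓞 ↥(maximalRealSubfield L))), ∀ S : Finset (HeightOneSpectrum (𝓞 ↥(maximalRealSubfield L))), S₁ ⊆ S →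
      IsEulerOnClasses (MatchingAdeleG₂.classes L H₁ H₂ γ₀)
        (UnitaryGroup.OrbitalMeasureFamily.ofLocalAdelic L 3 H₂ mq mqi) (fun x => w (ConjClasses.mk x) * T.eval x) S
        (fun v => localStableOrbitalIntegral L 3 H₂ v (mq v) (fun y => wloc v (ConjClasses.mk y) * T.loc v y)
          ((UnitaryGroup.cmDatum L 3 H₂).toLocal v
            ((UnitaryGroup.cmDatum L 3 H₂).toAdelic γ)))
        (archStableOrbitalIntegral L 3 H₂ mqi (fun a => warch (ConjClasses.mk a) * T.arch a)
          (cmRationalToArch L 3 H₂ γ)) := by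
  -- the relation at the correspondent `γ`, semisimplicity of `γ`
  have hγab' := mul_sub_smul_mul_sub_smul_eq_zero_of_isConj hγ hγab
  have hss : IsSemisimpleElt (cmConjRingHom L) H₂ γ := isSemisimple_toLin'_of_mul_sub_eq_zero hab hγab'
  exact MatchingAdeleG₂.exists_forall_isEulerOnClasses_ofLocalAdelic_classWeight_of_eventuallyKConj hH₂ hdet hγ
    (MatchingAdeleG₂.eventuallyKConj_rel_of_isSemisimpleElt hH₂ hdet hγ hss) mq mqi hadm hadmA
    (fun v => UnitaryGroup.isClosed_conjClass_localGL_of_mul_sub_eq_zero 3 v _ (isUnit_algebraMap_localRing_sub v hab)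
      (mul_sub_smul_toLocal_toAdelic_eq_zero v γ hγab'))
    (UnitaryGroup.isClosed_conjClass_mixedSpaceGL_of_mul_sub_eq_zero L 3 _ (isUnit_mixedEmbedding_sub hab)
      (mul_sub_smul_cmRationalToArch_eq_zero γ hγab'))
    hnormγ hnorm T hT w wloc warch hwE hw1

end EulerG2

end Literature.NumberTheory.Rogawski1990

end
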